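import Mathlib
import Literature.NumberTheory.EllipticCurves.ThreeIsogeny
import Literature.NumberTheory.EllipticCurves.MordellCurvePhiDescentHom
import Literature.NumberTheory.EllipticCurves.MordellCurveSqrtThreeEndomorphism
import Summits.BirchSwinnertonDyer.BirchSwinnertonDyer.Theorems.Rank2ObservatoryThreeIsoKummer
import Summits.BirchSwinnertonDyer.BirchSwinnertonDyer.Theorems.Rank2ObservatoryThreeIsoDual

/-!
# Rank-2 observatory, KERNEL-3ISO (A3b): `ker α ⊆ φ̂(Ê(ℚ))` — the `E`-side Kummer containment

HONEST FRAMING: per-curve certified theorems and census instruments; no claim on BSD in rank ≥ 2.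

Cell `bsd-rank2-observatory`, cert-1 leg KERNEL-3ISO. For `E = E_{m,s} : y² = x³ + (mx + s)²` over `ℚ`
(`threeTorsionModel m s`) with Vélu quotient `Ê = threeIsogenyCodomain m s`, the `3`-descent map
`α : E(ℚ) → ℚ*/ℚ*³` (`(x, y) ↦ y - (mx + s)` off `T = (0, s)`, `T ↦ (2s)²`, `O ↦ 1`; specified here by its
values, no definition) and the dual isogeny `φ̂ : Ê(ℚ) → E(ℚ)` (any additive `ψ` with Cohen's values
`(X, Y) ↦ (U/h², SY/h³)` off `X = -4m²/3`, as delivered by `ThreeIso.exists_dual_pointHom`):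

* `dual_preimage_of_T` (any field, `2 ≠ 0`): if `2s = c³` then `Q₀ = (3c² + 2mc, c(9c² + 6mc + 4m²)/2) ∈ Ê`
  has `U(X₀) = 0` and `S(X₀)Y₀ = s·h(X₀)³`, i.e. `φ̂(Q₀) = T` (the `X`-coordinates of `Ê[3] ∖ ker φ̂` are the
  roots of `U = ψ₃(Ê)/(3X + 4m²)`);
* **`ker_descent_le_range`** (over `ℚ`): `ker α ⊆ ψ(Ê(ℚ))` — `O` trivially; an affine `P ≠ T` with
  `y - (mx + s) = g³` by the Kummer algebra `ThreeIsoKummer.exists_dual_preimage_of_cube` (Cohen Lemma 8.4.5 /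
  Cor. 8.4.6 in characteristic-free form, needs `-3 ∉ ℚ²`); `T` with `(2s)²` a cube by `dual_preimage_of_T`.

This is hypothesis `hκ : κ.ker ≤ ψ.range` of `ThreeIso.three_pow_mordellWeilRank_succ_le_of_zsmul` for `κ = α`.

References: [Cohen2007NumberTheoryI] GTM 239, §8.4 (Prop. 8.4.3, Lemma 8.4.5, Cor. 8.4.6, Prop. 8.4.8);
[CohenPazuki2009] Prop. 2.2.
-/

noncomputable section

set_option linter.dupNamespace false

open scoped Classical

open WeierstrassCurve Polynomial

namespace Summit.BirchSwinnertonDyer.BirchSwinnertonDyer.Rank2Observatory.ThreeIso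

open Literature.NumberTheory.EllipticCurves Literature.NumberTheory.EllipticCurves.MordellDescent

/-! ### The dual preimage of `T` when `2s` is a cube (any field with `2 ≠ 0`) -/

section Field

variable {F : Type*} [Field F] {m s : F}

/-- If `2s = c³` then `X₀ = 3c² + 2mc`, `Y₀ = c(9c² + 6mc + 4m²)/2` satisfy: `(X₀, Y₀) ∈ Ê`,
`h(X₀) = 3X₀ + 4m² = 9c² + 6mc + 4m²`, `U(X₀) = 0`, and `S(X₀) Y₀ = s h(X₀)³` — so `φ̂(X₀, Y₀) = (0, s) = T`
whenever `h(X₀) ≠ 0`. [cite: Cohen2007NumberTheoryI, Prop. 8.4.3] -/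
theorem dual_preimage_of_T (h2 : (2 : F) ≠ 0) {c : F} (hc : c ^ 3 = 2 * s) :
    let X₀ := 3 * c ^ 2 + 2 * m * c
    let Y₀ := c * (9 * c ^ 2 + 6 * m * c + 4 * m ^ 2) / 2
    Y₀ ^ 2 = X₀ ^ 3 + m ^ 2 * X₀ ^ 2 - 18 * m * s * X₀ - (27 * s ^ 2 + 16 * m ^ 3 * s) ∧
      3 * X₀ + 4 * m ^ 2 = 9 * c ^ 2 + 6 * m * c + 4 * m ^ 2 ∧
      X₀ ^ 3 - 36 * m * s * X₀ - (108 * s ^ 2 + 16 * m ^ 3 * s) = 0 ∧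
      (X₀ ^ 3 + 4 * m ^ 2 * X₀ ^ 2 + 36 * m * s * X₀ + (216 * s ^ 2 - 16 * m ^ 3 * s)) * Y₀ =
        s * (3 * X₀ + 4 * m ^ 2) ^ 3 := by
  intro X₀ Y₀
  have hs : s = c ^ 3 / 2 := by rw [eq_div_iff h2]; linear_combination -hc
  subst hs
  refine ⟨?_, ?_, ?_, ?_⟩
  · simp only [X₀, Y₀]; field_simp; ring
  · simp only [X₀]; ring
  · simp only [X₀]; field_simp; ring
  · simp only [X₀, Y₀]; field_simp; ring

end Field

/-! ### Over `ℚ`: the kernel of `α` lies in the image of the dual isogeny -/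

section Rational

/-- `-3` is not a square in `ℚ`. [folklore] -/
theorem sq_ne_neg_three (z : ℚ) : z ^ 2 ≠ -3 := fun h => by nlinarith [sq_nonneg z]

/-- `9c² + 6mc + 4m² ≠ 0` for `c ≠ 0` in `ℚ` (`= (3c + m)² + 3m²`). [folklore] -/
theorem h_at_preimage_ne_zero {m c : ℚ} (hc : c ≠ 0) : 9 * c ^ 2 + 6 * m * c + 4 * m ^ 2 ≠ 0 := by
  intro e
  have hm2 : m ^ 2 = 0 := by nlinarith [sq_nonneg (3 * c + m), sq_nonneg m]
  have hm : m = 0 := pow_eq_zero_iff two_ne_zero |>.mp hm2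
  rw [hm] at e
  have : c ^ 2 = 0 := by nlinarith
  exact hc (pow_eq_zero_iff two_ne_zero |>.mp this)

/-- **`ker α ⊆ φ̂(Ê(ℚ))`** (the `E`-side Kummer containment, hypothesis `hκ` of the index bound): for any additive
`κ` on `E_{m,s}(ℚ)` with the descent values and any additive `ψ : Ê(ℚ) → E(ℚ)` with Cohen's dual values off
`X = -4m²/3`, every point killed by `κ` is in the range of `ψ`.
[cite: Cohen2007NumberTheoryI, Prop. 8.4.8 with Lemma 8.4.5 and Cor. 8.4.6] -/
theorem ker_descent_le_range {m s : ℚ} (h : IsVeluThreePair m s (threeTorsionModel m s)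
    (threeIsogenyCodomain m s))
    (κ : (threeTorsionModel m s).toAffine.Point →+ Additive (CubeUnits ℚ))
    (hκ : ∀ (x y : ℚ) (hP : (threeTorsionModel m s).toAffine.Nonsingular x y), κ (.some x y hP) =
      Additive.ofMul (cubeClass (if y = m * x + s then (2 * s) ^ 2 else y - (m * x + s))))
    (ψ : (threeIsogenyCodomain m s).toAffine.Point →+ (threeTorsionModel m s).toAffine.Point)
    (hψ : ∀ (X Y : ℚ) (hQ : (threeIsogenyCodomain m s).toAffine.Nonsingular X Y)
      (hX : 3 * X + 4 * m ^ 2 ≠ 0), ψ (.some X Y hQ) = .some _ _ (nonsingular_dual_value h hQ hX)) :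
    κ.ker ≤ ψ.range := by
  have h2 : (2 : ℚ) ≠ 0 := by norm_num
  have h3 : (3 : ℚ) ≠ 0 := by norm_num
  have h2s : (2 : ℚ) * s ≠ 0 := mul_ne_zero h2 h.s_ne
  intro P hP
  rcases P with _ | ⟨x, y, hxy⟩
  · rw [← Affine.Point.zero_def]; exact zero_mem _
  rw [AddMonoidHom.mem_ker, hκ, ofMul_eq_zero] at hP
  by_cases hy : y = m * x + s
  · /- `P = T`: `(2s)²` is a cube, so `2s = c³`, and `T = ψ(Q₀)` -/
    rw [if_pos hy, cubeClass_eq_one_iff (pow_ne_zero 2 h2s)] at hP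
    obtain ⟨c', hc'0, e⟩ := hP
    -- `2s = (2s/c')³`
    set c := 2 * s / c' with hcdef
    have hc0 : c ≠ 0 := div_ne_zero h2s hc'0
    have hc : c ^ 3 = 2 * s := by
      rw [hcdef, div_pow, ← e, div_eq_iff (pow_ne_zero 2 h2s)]; ring
    -- `P = (0, s)`
    have hE := (h.equation_iff x y).mp hxy.left
    have hx3 : x ^ 3 = 0 := by
      have : (y - (m * x + s)) * (y + (m * x + s)) = x ^ 3 := by linear_combination hE
      rw [← this, hy]; ring
    have hx0 : x = 0 := pow_eq_zero_iff three_ne_zero |>.mp hx3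
    have hys : y = s := by rw [hy, hx0]; ring
    obtain ⟨hQ₀, hh, hU, hS⟩ := dual_preimage_of_T (m := m) h2 hc
    have hh0 : 3 * (3 * c ^ 2 + 2 * m * c) + 4 * m ^ 2 ≠ 0 := by
      rw [hh]; exact h_at_preimage_ne_zero hc0
    have hQ : (threeIsogenyCodomain m s).toAffine.Nonsingular (3 * c ^ 2 + 2 * m * c)
        (c * (9 * c ^ 2 + 6 * m * c + 4 * m ^ 2) / 2) :=
      (Affine.equation_iff_nonsingular_of_Δ_ne_zero (W := (threeIsogenyCodomain m s).toAffine)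
        h.Δ'_ne).mp ((h.equation'_iff _ _).mpr hQ₀)
    refine ⟨.some _ _ hQ, ?_⟩
    rw [hψ _ _ hQ hh0]
    refine SqrtThree.some_eq_some ?_ ?_
    · rw [hx0, hU, zero_div]
    · rw [hys, div_eq_iff (pow_ne_zero 3 hh0), hS]
  · /- `P ≠ T`: `y - (mx + s) = g³`, Kummer algebra -/
    rw [if_neg hy, cubeClass_eq_one_iff (sub_ne_zero.mpr hy)] at hP
    obtain ⟨g, hg0, hcube⟩ := hP
    obtain ⟨X, Y, hQ, hX, hx, hy'⟩ :=
      ThreeIsoKummer.exists_dual_preimage_of_cube h h3 sq_ne_neg_three hxy hg0 hcube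
    exact ⟨.some X Y hQ, by rw [hψ X Y hQ hX]; exact SqrtThree.some_eq_some hx hy'⟩

end Rational

end Summit.BirchSwinnertonDyer.BirchSwinnertonDyer.Rank2Observatory.ThreeIso
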